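import Summits.Ventures.CertifiedManyBodySolver.Downfold.EmeryThermalCapFromFloorSeam
import Mathlib.Analysis.Convex.Jensen
import HarnessLib

/-!
# THE THERMAL BAND SEAM: FUNCTION-VALUED `T > 0` words on a typed Emery box — the BILINEAR cap interpolating the four corner caps (convexity on the
# lower face + anti-monotonicity in the tail) and the pointwise Rayleigh-family floor; La₂CuO₄ #18 instantiated (the `T > 0` twin of KLDL-V)

Venture CertifiedManyBodySolver, cell `pub/hubbard-downfold` (S1 = ROUTER) × crew hubbard-fast S2 (ii) × (iv) «T > 0 × multi-band» (D-0096 (ii)); seat hubbard-downfold-mod-4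
(S1/S2 Emery seam). Namespace `Summit.Ventures.CertifiedManyBodySolver.Downfold`.

WHY: a box-wide CONSTANT cap `P_cell ≤ 6 log 2 + β·c` (`EmeryThermalCapFromFloorSeam`, `c = maxᵢ(−q₀ᵢ/M)`) is the worst corner's slope everywhere, while the four
corner slopes differ by up to `13·β` per CuO₂ (Hg-1223 OP: 41.1 … 54.4). At `T > 0` the cell pressure is CONVEX along the physical line
(`convexOn_emeryCellPressure_line`), so on the lower face `(t_pd, t_pp) ∈ [lo₀, hi₀] × [lo₁, hi₁]` it lies BELOW the bilinear interpolant of its four corner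
values (Jensen with the tensor weights `(1−a)(1−b), a(1−b), (1−a)b, ab`, `a = (t_pd − lo₀)/(hi₀ − lo₀)`, `b = (t_pp − lo₁)/(hi₁ − lo₁)`), and raising the tail
`(ε_d, ε_p, U_d, U_p)` only lowers it (`emeryCellPressure_line_anti_tail`). Hence four corner caps `Mᵢ` give the FUNCTION-VALUED cap
`P_cell(β, q) ≤ Σᵢ wᵢ(t_pd, t_pp)·Mᵢ` at every point of the six-box — equal to `Mᵢ` at corner `i`, to the mean of the four at the face centre, never above `max Mᵢ`.
The floor side is function-valued for free: an orthonormal cluster family's Gibbs–Peierls bound at the POINT `q` is `¼ log Σⱼ exp(−β·ℓⱼ(q))` with the members'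
AFFINE Rayleigh forms `ℓⱼ(q) = Σ_k q_k·lineCoeff_k` (`affineCapBound s T q q`, §1).

* §1 `affineCapBound_self` (at a point the closed-form box bound IS the affine form) and **`holdsOn_emeryCellPressureFloor_pointFamily`** (the pointwise family
  floor as a typed word: `¼ log Σⱼ exp(−β·Σ_k q_k(p)·ℓⱼₖ) ≤ P_cell(β, θ_εp(p))` on any typed box — indeed at every `p`).
* §2 **`emeryCellPressure_line_le_bilinear`** (weights form: `q₀ = (1−a)lo₀ + a·hi₀`, `q₁ = (1−b)lo₁ + b·hi₁`, tail ≥ lower ends, `a, b ∈ [0,1]` ⇒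
  `P_cell(β, emeryLine s q) ≤ (1−a)(1−b)M₀ + a(1−b)M₁ + (1−a)bM₂ + abM₃`) and **`emeryCellPressure_line_le_bilinear_of_mem_Icc`** (closed form on the six-box
  `[lo, hi]` with `lo₀ < hi₀`, `lo₁ < hi₁`:
  `P_cell ≤ ((hi₀−q₀)(hi₁−q₁)M₀ + (q₀−lo₀)(hi₁−q₁)M₁ + (hi₀−q₀)(q₁−lo₁)M₂ + (q₀−lo₀)(q₁−lo₁)M₃) / ((hi₀−lo₀)(hi₁−lo₁))`).
* §3 the typed doors **`holdsOn_emeryCellPressureBilinearCap_of_cornerCaps`** (any Emery box with the five seam entries and non-degenerate `t_pd`, `t_pp` rows,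
  any level `εp`, any sign pattern) and **`holdsOn_emeryCellPressureBilinearCap_of_tiltedCuO4Certificates`** (the corner caps supplied by the landed floor words'
  `CuO₄` certificates exactly as in `holdsOn_emeryCellPressureCap_of_tiltedCuO4Certificates`: `Mᵢ = 6 log 2 + β·(−q₀ᵢ/M)` at a common level `εp ≥ μᵢ`).
* §4 La₂CuO₄ (#18, `emeryBoxLa214v123`, level `εp = −17/2`, slopes `c = −q₀/2 = (588601/16000, 6394021/156250, 126879/3200, 54123877/1250000)`, face
  `[1.29, 1.52] × [0.46, 0.66]`): **`emeryBoxLa214v123_pressureBilinearCap_m17o2`** —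
  `P_cell(β, θ(p)) ≤ 6 log 2 + β·((38/25 − t_pd)(33/50 − t_pp)·c₀ + (t_pd − 129/100)(33/50 − t_pp)·c₁ + (38/25 − t_pd)(t_pp − 23/50)·c₂ + (t_pd − 129/100)(t_pp − 23/50)·c₃)/(23/500)`
  at every point, every β ≥ 0, hypothesis-free; readings: corner (1.29, 0.46) slope `36.7875625` (vs the constant word's `43.2991016`), face centre (1.405, 0.56) slope
  `40.1645215` = the mean of the four, corner (1.52, 0.66) `43.2991016`; and the pointwise family floor from `kryFam_La214T_tlhl` as the lower edge of the band
  (`emeryBoxLa214v123_pressureFloorPointFamT`).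

Everything PROVED (0 sorry); no definition. HONEST FRAMING: CERTIFIED inequalities on a SCREENING-GRADE object; the cap still carries the full entropy `6 log 2`
per CuO₂ and each corner slope is a single-`CuO₄` Anderson bound raised to the common level by monotonicity; the interpolation is exact only in `(t_pd, t_pp)` —
in the tail the cap is the lower-end value (loose at large `U`); no phase word; no router number moves.
-/

noncomputable section

namespace Summit.Ventures.CertifiedManyBodySolver.Downfold

open NonemptyInterval Matrix Finset Literature.Probability.LatticeModels
open Literature.MathematicalPhysics.QuantumLattice Literature.Computation.Certificates
open Summit.Ventures.CertifiedManyBodySolver.Certificates OccupationCode ClusterLowerBound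
open scoped BigOperators ComplexOrder

/-! ## §1 The pointwise family floor is already function-valued -/

/-- At a point the closed-form box bound is the affine Rayleigh form itself: `affineCapBound s T q q = Σ_k q_k·lineCoeff s T k`. [folklore] -/
theorem affineCapBound_self (s : Fin 4 → ℝ) (T : Fin 14 → ℝ) (q : Fin 6 → ℝ) :
    affineCapBound s T q q = ∑ k, q k * lineCoeff s T k := by
  simp [affineCapBound]

/-- **THE POINTWISE FAMILY FLOOR AS A TYPED WORD.** For `β ≥ 0`, an orthonormal family `φⱼ` of `Cu₄O₈` cluster vectors with exact per-atom traces `T j`, any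
sign pattern and level: at EVERY point `p`, `¼·log Σⱼ exp(−β·Σ_k (emeryLineCoords εp p)_k · lineCoeff s (T j) k) ≤ P_cell(β, emeryLine s (emeryLineCoords εp p))` —
the lower edge of the thermal band MOVES with the parameters (Gibbs–Peierls at the point; no box slack). [cite: Ruelle1969, §2.5–2.6] [cite: Israel1979, Lemma II.3.1] -/
theorem holdsOn_emeryCellPressureFloor_pointFamily (E : EmeryBox) (εp : ℝ) (s : Fin 4 → ℝ) {β : ℝ} (hβ : 0 ≤ β)
    {ι : Type*} [Fintype ι] [DecidableEq ι] [Nonempty ι]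
    {φ : ι → Fock (Orb (Fin 1 ×ₗ Fin 12))} (hφ : ∀ i j, star (φ i) ⬝ᵥ φ j = if i = j then 1 else 0)
    {T : ι → Fin 14 → ℝ} (hT : ∀ i a, (star (φ i) ⬝ᵥ (hubbardOpenBoxGP 1 12 (cu4o8Tau a) (cu4o8Ups a) (cu4o8Nu a) *ᵥ φ i)).re = T i a) :
    HoldsOn (fun p : EmeryCoord → ℝ =>
      Real.log (∑ j, Real.exp (-(β * ∑ k, emeryLineCoords εp p k * lineCoeff s (T j) k))) / 4 ≤
        emeryCellPressure β (emeryLine s (emeryLineCoords εp p))) E := by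
  intro p _
  have h := le_emeryCellPressure_line_of_rayleighTraces hβ s hφ hT (emeryLineCoords εp p) (emeryLineCoords εp p)
    (q := emeryLineCoords εp p) (Set.mem_Icc.2 ⟨le_rfl, le_rfl⟩)
  simp only [affineCapBound_self] at h
  exact h

/-! ## §2 The bilinear cap on the lower face -/

/-- **BILINEAR CAP, weights form.** `β ≥ 0`; corner caps `P_cell(β, emeryLine s (lowerCorner lo hi i)) ≤ Mᵢ`; a point `q` whose lower-face coordinates are
`q₀ = (1−a)·lo₀ + a·hi₀`, `q₁ = (1−b)·lo₁ + b·hi₁` with `a, b ∈ [0,1]` and whose tail dominates the lower ends ⇒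
`P_cell(β, emeryLine s q) ≤ (1−a)(1−b)·M₀ + a(1−b)·M₁ + (1−a)b·M₂ + ab·M₃`. [cite: Israel1979, Thm. I.3.4] -/
theorem emeryCellPressure_line_le_bilinear {β : ℝ} (hβ : 0 ≤ β) (s : Fin 4 → ℝ) (lo hi : Fin 6 → ℝ) {M : Fin 4 → ℝ}
    (hM : ∀ i : Fin 4, emeryCellPressure β (emeryLine s (lowerCorner lo hi i)) ≤ M i)
    {a b : ℝ} (ha0 : 0 ≤ a) (ha1 : a ≤ 1) (hb0 : 0 ≤ b) (hb1 : b ≤ 1) {q : Fin 6 → ℝ}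
    (hq0 : q 0 = (1 - a) * lo 0 + a * hi 0) (hq1 : q 1 = (1 - b) * lo 1 + b * hi 1)
    (h2 : lo 2 ≤ q 2) (h3 : lo 3 ≤ q 3) (h4 : lo 4 ≤ q 4) (h5 : lo 5 ≤ q 5) :
    emeryCellPressure β (emeryLine s q) ≤ (1 - a) * (1 - b) * M 0 + a * (1 - b) * M 1 + (1 - a) * b * M 2 + a * b * M 3 := by
  have hf := convexOn_emeryCellPressure_line β s
  have ha1' : 0 ≤ 1 - a := sub_nonneg.2 ha1
  have hb1' : 0 ≤ 1 - b := sub_nonneg.2 hb1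
  -- the four face points with the tail of `q`, and the two edge points
  have hLL : emeryCellPressure β (emeryLine s (![lo 0, lo 1, q 2, q 3, q 4, q 5] : Fin 6 → ℝ)) ≤ M 0 := by
    refine le_trans (emeryCellPressure_line_anti_tail hβ s (q := lowerCorner lo hi 0) (fun k => ?_) ?_ ?_) (hM 0)
    · fin_cases k <;> simp [lowerCorner, h2, h3, h4, h5]
    · simp [lowerCorner]
    · simp [lowerCorner]
  have hHL : emeryCellPressure β (emeryLine s (![hi 0, lo 1, q 2, q 3, q 4, q 5] : Fin 6 → ℝ)) ≤ M 1 := by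
    refine le_trans (emeryCellPressure_line_anti_tail hβ s (q := lowerCorner lo hi 1) (fun k => ?_) ?_ ?_) (hM 1)
    · fin_cases k <;> simp [lowerCorner, h2, h3, h4, h5]
    · simp [lowerCorner]
    · simp [lowerCorner]
  have hLH : emeryCellPressure β (emeryLine s (![lo 0, hi 1, q 2, q 3, q 4, q 5] : Fin 6 → ℝ)) ≤ M 2 := by
    refine le_trans (emeryCellPressure_line_anti_tail hβ s (q := lowerCorner lo hi 2) (fun k => ?_) ?_ ?_) (hM 2)
    · fin_cases k <;> simp [lowerCorner, h2, h3, h4, h5]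
    · simp [lowerCorner]
    · simp [lowerCorner]
  have hHH : emeryCellPressure β (emeryLine s (![hi 0, hi 1, q 2, q 3, q 4, q 5] : Fin 6 → ℝ)) ≤ M 3 := by
    refine le_trans (emeryCellPressure_line_anti_tail hβ s (q := lowerCorner lo hi 3) (fun k => ?_) ?_ ?_) (hM 3)
    · fin_cases k <;> simp [lowerCorner, h2, h3, h4, h5]
    · simp [lowerCorner]
    · simp [lowerCorner]
  -- convex combinations along t_pd on the two edges
  have eB0 : (1 - a) • (![lo 0, lo 1, q 2, q 3, q 4, q 5] : Fin 6 → ℝ) + a • (![hi 0, lo 1, q 2, q 3, q 4, q 5] : Fin 6 → ℝ) =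
      (![q 0, lo 1, q 2, q 3, q 4, q 5] : Fin 6 → ℝ) := by
    ext k
    fin_cases k <;> simp [hq0] <;> ring
  have eB1 : (1 - a) • (![lo 0, hi 1, q 2, q 3, q 4, q 5] : Fin 6 → ℝ) + a • (![hi 0, hi 1, q 2, q 3, q 4, q 5] : Fin 6 → ℝ) =
      (![q 0, hi 1, q 2, q 3, q 4, q 5] : Fin 6 → ℝ) := by
    ext k
    fin_cases k <;> simp [hq0] <;> ring
  have eQ : (1 - b) • (![q 0, lo 1, q 2, q 3, q 4, q 5] : Fin 6 → ℝ) + b • (![q 0, hi 1, q 2, q 3, q 4, q 5] : Fin 6 → ℝ) = q := by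
    ext k
    fin_cases k <;> simp [hq1] <;> ring
  have hab : (1 - a) + a = 1 := by ring
  have hbb : (1 - b) + b = 1 := by ring
  have hB0 := hf.2 (Set.mem_univ (![lo 0, lo 1, q 2, q 3, q 4, q 5] : Fin 6 → ℝ)) (Set.mem_univ (![hi 0, lo 1, q 2, q 3, q 4, q 5] : Fin 6 → ℝ)) ha1' ha0 hab
  have hB1 := hf.2 (Set.mem_univ (![lo 0, hi 1, q 2, q 3, q 4, q 5] : Fin 6 → ℝ)) (Set.mem_univ (![hi 0, hi 1, q 2, q 3, q 4, q 5] : Fin 6 → ℝ)) ha1' ha0 hab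
  rw [eB0] at hB0
  rw [eB1] at hB1
  have hQ := hf.2 (Set.mem_univ (![q 0, lo 1, q 2, q 3, q 4, q 5] : Fin 6 → ℝ)) (Set.mem_univ (![q 0, hi 1, q 2, q 3, q 4, q 5] : Fin 6 → ℝ)) hb1' hb0 hbb
  rw [eQ] at hQ
  simp only [smul_eq_mul] at hB0 hB1 hQ
  -- weights are nonnegative: chain the bounds
  have k1 := mul_le_mul_of_nonneg_left hLL ha1'
  have k2 := mul_le_mul_of_nonneg_left hHL ha0
  have k3 := mul_le_mul_of_nonneg_left hLH ha1'
  have k4 := mul_le_mul_of_nonneg_left hHH ha0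
  have e0 : emeryCellPressure β (emeryLine s (![q 0, lo 1, q 2, q 3, q 4, q 5] : Fin 6 → ℝ)) ≤ (1 - a) * M 0 + a * M 1 := by linarith
  have e1 : emeryCellPressure β (emeryLine s (![q 0, hi 1, q 2, q 3, q 4, q 5] : Fin 6 → ℝ)) ≤ (1 - a) * M 2 + a * M 3 := by linarith
  have k5 := mul_le_mul_of_nonneg_left e0 hb1'
  have k6 := mul_le_mul_of_nonneg_left e1 hb0
  have fin : emeryCellPressure β (emeryLine s q) ≤ (1 - b) * ((1 - a) * M 0 + a * M 1) + b * ((1 - a) * M 2 + a * M 3) := by linarith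
  have e : (1 - b) * ((1 - a) * M 0 + a * M 1) + b * ((1 - a) * M 2 + a * M 3) =
      (1 - a) * (1 - b) * M 0 + a * (1 - b) * M 1 + (1 - a) * b * M 2 + a * b * M 3 := by ring
  linarith

/-- **BILINEAR CAP, closed form on the six-box** (`lo₀ < hi₀`, `lo₁ < hi₁`, `q ∈ [lo, hi]`, `β ≥ 0`, corner caps `Mᵢ`):
`P_cell(β, emeryLine s q) ≤ ((hi₀−q₀)(hi₁−q₁)M₀ + (q₀−lo₀)(hi₁−q₁)M₁ + (hi₀−q₀)(q₁−lo₁)M₂ + (q₀−lo₀)(q₁−lo₁)M₃) / ((hi₀−lo₀)(hi₁−lo₁))`.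
[cite: Israel1979, Thm. I.3.4] -/
theorem emeryCellPressure_line_le_bilinear_of_mem_Icc {β : ℝ} (hβ : 0 ≤ β) (s : Fin 4 → ℝ) (lo hi : Fin 6 → ℝ)
    (h0 : lo 0 < hi 0) (h1 : lo 1 < hi 1) {M : Fin 4 → ℝ}
    (hM : ∀ i : Fin 4, emeryCellPressure β (emeryLine s (lowerCorner lo hi i)) ≤ M i) {q : Fin 6 → ℝ} (hq : q ∈ Set.Icc lo hi) :
    emeryCellPressure β (emeryLine s q) ≤
      ((hi 0 - q 0) * (hi 1 - q 1) * M 0 + (q 0 - lo 0) * (hi 1 - q 1) * M 1 + (hi 0 - q 0) * (q 1 - lo 1) * M 2 +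
        (q 0 - lo 0) * (q 1 - lo 1) * M 3) / ((hi 0 - lo 0) * (hi 1 - lo 1)) := by
  have hd0 : 0 < hi 0 - lo 0 := sub_pos.2 h0
  have hd1 : 0 < hi 1 - lo 1 := sub_pos.2 h1
  have hq0l : lo 0 ≤ q 0 := hq.1 0
  have hq0h : q 0 ≤ hi 0 := hq.2 0
  have hq1l : lo 1 ≤ q 1 := hq.1 1
  have hq1h : q 1 ≤ hi 1 := hq.2 1
  have h := emeryCellPressure_line_le_bilinear hβ s lo hi hM (a := (q 0 - lo 0) / (hi 0 - lo 0)) (b := (q 1 - lo 1) / (hi 1 - lo 1))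
    (div_nonneg (sub_nonneg.2 hq0l) hd0.le) ((div_le_one hd0).2 (sub_le_sub_right hq0h _))
    (div_nonneg (sub_nonneg.2 hq1l) hd1.le) ((div_le_one hd1).2 (sub_le_sub_right hq1h _))
    (q := q) (by field_simp; ring) (by field_simp; ring) (hq.1 2) (hq.1 3) (hq.1 4) (hq.1 5)
  refine h.trans (le_of_eq ?_)
  field_simp
  ring

/-! ## §3 The typed doors -/

/-- **THE BILINEAR THERMAL CAP DOOR on a typed Emery box.** The five seam entries with NON-DEGENERATE `t_pd` and `t_pp` rows, `β ≥ 0`, any sign pattern and level,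
four corner caps `Mᵢ` at `lowerCorner (emeryLo εp …) (emeryHi εp …) i` ⇒ at every point `p` of the box
`P_cell(β, θ_εp(p)) ≤ ((A.hi − t_pd)(B.hi − t_pp)M₀ + (t_pd − A.lo)(B.hi − t_pp)M₁ + (A.hi − t_pd)(t_pp − B.lo)M₂ + (t_pd − A.lo)(t_pp − B.lo)M₃)/((A.hi − A.lo)(B.hi − B.lo))`.
[cite: Israel1979, Thm. I.3.4] -/
theorem holdsOn_emeryCellPressureBilinearCap_of_cornerCaps {E : EmeryBox} {eA eB eD eUd eUp : Entry} {εp : ℚ}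
    (hA : E .tpd = some eA) (hB : E .tpp = some eB) (hD : E .DeltaPd = some eD)
    (hUd : E .Udd = some eUd) (hUp : E .Upp = some eUp) (hA' : eA.encl.fst < eA.encl.snd) (hB' : eB.encl.fst < eB.encl.snd)
    (s : Fin 4 → ℝ) {β : ℝ} (hβ : 0 ≤ β) {M : Fin 4 → ℝ}
    (hM : ∀ i : Fin 4, emeryCellPressure β (emeryLine s (lowerCorner (emeryLo εp eA eB eD eUd eUp) (emeryHi εp eA eB eD eUd eUp) i)) ≤ M i) :
    HoldsOn (fun p : EmeryCoord → ℝ => emeryCellPressure β (emeryLine s (emeryLineCoords (εp : ℝ) p)) ≤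
      ((((eA.encl.snd : ℚ) : ℝ) - p .tpd) * (((eB.encl.snd : ℚ) : ℝ) - p .tpp) * M 0 +
        (p .tpd - ((eA.encl.fst : ℚ) : ℝ)) * (((eB.encl.snd : ℚ) : ℝ) - p .tpp) * M 1 +
        (((eA.encl.snd : ℚ) : ℝ) - p .tpd) * (p .tpp - ((eB.encl.fst : ℚ) : ℝ)) * M 2 +
        (p .tpd - ((eA.encl.fst : ℚ) : ℝ)) * (p .tpp - ((eB.encl.fst : ℚ) : ℝ)) * M 3) /
        ((((eA.encl.snd : ℚ) : ℝ) - ((eA.encl.fst : ℚ) : ℝ)) * (((eB.encl.snd : ℚ) : ℝ) - ((eB.encl.fst : ℚ) : ℝ)))) E := by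
  intro p hp
  have h := emeryCellPressure_line_le_bilinear_of_mem_Icc hβ s (emeryLo εp eA eB eD eUd eUp) (emeryHi εp eA eB eD eUd eUp)
    (by simpa [emeryLo, emeryHi] using hA') (by simpa [emeryLo, emeryHi] using hB') hM (emeryLineCoords_mem_Icc hA hB hD hUd hUp hp)
  simpa [emeryLo, emeryHi, emeryLineCoords] using h

/-- **THE BILINEAR THERMAL CAP FROM THE FLOOR WORDS' CERTIFICATES.** As `holdsOn_emeryCellPressureCap_of_tiltedCuO4Certificates` (the four `hq i` verbatim, a common
level `εp ≥ μ i`), but the corner slopes `−q₀ᵢ/M` are INTERPOLATED instead of maximised: at every point of the box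
`P_cell ≤ 6 log 2 + β·(Σᵢ wᵢ(t_pd, t_pp)·(−q₀ᵢ/M))` (tensor weights on the `t_pd × t_pp` face). [cite: Israel1979, Thm. I.2.4] [cite: ValentiStolzeHirschfeld1991, §II] -/
theorem holdsOn_emeryCellPressureBilinearCap_of_tiltedCuO4Certificates {E : EmeryBox} {eA eB eD eUd eUp : Entry}
    (hA : E .tpd = some eA) (hB : E .tpp = some eB) (hD : E .DeltaPd = some eD)
    (hUd : E .Udd = some eUd) (hUp : E .Upp = some eUp) (hA' : eA.encl.fst < eA.encl.snd) (hB' : eB.encl.fst < eB.encl.snd)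
    (s : Fin 4 → ℝ) {β : ℝ} (hβ : 0 ≤ β) {M : ℝ} (hM : 0 < M)
    (G : Fin 4 → FermionOp emeryCuO4Window)
    (hG0 : ∀ i, ∀ ω' : InfVolFermionState 2, ω'.IsPeriodic liebPeriods → (ω'.expect emeryCuO4Window (G i)).re = 0)
    (μ q₀ : Fin 4 → ℝ)
    (hq : ∀ i : Fin 4, ((⟨fun X => (uniformPeriodicWeight liebPeriods emeryCuO4Window M X : ℂ) •
        (emeryInteraction (emeryLine s (lowerCorner (emeryLo 0 eA eB eD eUd eUp) (emeryHi 0 eA eB eD eUd eUp) i) +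
          μ i • levelDir)).Φ X⟩ : FermionInteraction 2).localHamiltonian emeryCuO4Window + G i -
        (q₀ i : ℂ) • (1 : FermionOp emeryCuO4Window)).PosSemidef)
    {εp : ℚ} (hμ : ∀ i, μ i ≤ εp) :
    HoldsOn (fun p : EmeryCoord → ℝ => emeryCellPressure β (emeryLine s (emeryLineCoords (εp : ℝ) p)) ≤
      ((((eA.encl.snd : ℚ) : ℝ) - p .tpd) * (((eB.encl.snd : ℚ) : ℝ) - p .tpp) * (6 * Real.log 2 + β * (-q₀ 0 / M)) +
        (p .tpd - ((eA.encl.fst : ℚ) : ℝ)) * (((eB.encl.snd : ℚ) : ℝ) - p .tpp) * (6 * Real.log 2 + β * (-q₀ 1 / M)) +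
        (((eA.encl.snd : ℚ) : ℝ) - p .tpd) * (p .tpp - ((eB.encl.fst : ℚ) : ℝ)) * (6 * Real.log 2 + β * (-q₀ 2 / M)) +
        (p .tpd - ((eA.encl.fst : ℚ) : ℝ)) * (p .tpp - ((eB.encl.fst : ℚ) : ℝ)) * (6 * Real.log 2 + β * (-q₀ 3 / M))) /
        ((((eA.encl.snd : ℚ) : ℝ) - ((eA.encl.fst : ℚ) : ℝ)) * (((eB.encl.snd : ℚ) : ℝ) - ((eB.encl.fst : ℚ) : ℝ)))) E :=
  holdsOn_emeryCellPressureBilinearCap_of_cornerCaps hA hB hD hUd hUp hA' hB' s hβ (M := fun i => 6 * Real.log 2 + β * (-q₀ i / M)) fun i =>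
    (emeryCellPressure_corner_level_le hβ s eA eB eD eUd eUp i (hμ i)).trans
      (emeryCellPressure_tiltedCorner_le_of_cuO4Certificate hβ _ (μ i) hM (hG0 i) (hq i))

/-! ## §4 La₂CuO₄ (#18): the function-valued thermal band on `emeryBoxLa214v123` at level `εp = −17/2` -/

/-- **THE La₂CuO₄ BILINEAR THERMAL CAP (hypothesis-free)**, cuprate signs, level `εp = −17/2`, EVERY β ≥ 0, EVERY point `p` of `emeryBoxLa214v123`
(face `t_pd ∈ [129/100, 38/25]`, `t_pp ∈ [23/50, 33/50]`; corner slopes `c = (588601/16000, 6394021/156250, 126879/3200, 54123877/1250000)`):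
`P_cell(β, θ(p)) ≤ ((38/25 − t_pd)(33/50 − t_pp)(6 log 2 + β c₀) + (t_pd − 129/100)(33/50 − t_pp)(6 log 2 + β c₁) + (38/25 − t_pd)(t_pp − 23/50)(6 log 2 + β c₂)
+ (t_pd − 129/100)(t_pp − 23/50)(6 log 2 + β c₃)) / (23/500)` — slope `36.7875625·β` at corner (1.29, 0.46), `40.1645215·β` at the face centre, `43.2991016·β`
only at corner (1.52, 0.66) (the constant word's value everywhere). [cite: Israel1979, Thm. I.3.4] [cite: ValentiStolzeHirschfeld1991, §II] -/
theorem emeryBoxLa214v123_pressureBilinearCap_m17o2 {β : ℝ} (hβ : 0 ≤ β) :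
    HoldsOn (fun p : EmeryCoord → ℝ => emeryCellPressure β (emeryLine cuprateSigns (emeryLineCoords (((-17/2 : ℚ)) : ℝ) p)) ≤
      (((38/25 : ℝ) - p .tpd) * ((33/50 : ℝ) - p .tpp) * (6 * Real.log 2 + β * (588601/16000)) +
        (p .tpd - (129/100 : ℝ)) * ((33/50 : ℝ) - p .tpp) * (6 * Real.log 2 + β * (6394021/156250)) +
        ((38/25 : ℝ) - p .tpd) * (p .tpp - (23/50 : ℝ)) * (6 * Real.log 2 + β * (126879/3200)) +
        (p .tpd - (129/100 : ℝ)) * (p .tpp - (23/50 : ℝ)) * (6 * Real.log 2 + β * (54123877/1250000))) / (23/500 : ℝ)) emeryBoxLa214v123 := by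
  have h := holdsOn_emeryCellPressureBilinearCap_of_tiltedCuO4Certificates (E := emeryBoxLa214v123) emeryBoxLa214v123_entries.1 emeryBoxLa214v123_entries.2.1
    emeryBoxLa214v123_entries.2.2.1 emeryBoxLa214v123_entries.2.2.2.1 emeryBoxLa214v123_entries.2.2.2.2.1
    (by rw [la214Emery_tpd, Entry.encl_ofEnds_fst, Entry.encl_ofEnds_snd]; norm_num)
    (by rw [la214Emery_tpp, Entry.encl_ofEnds_fst, Entry.encl_ofEnds_snd]; norm_num)
    cuprateSigns hβ (M := 2) two_pos (fun _ => 0) (fun _ ω' _ => re_expect_zero_cuO4 ω') la214Floor54_mu la214Floor54_q0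
    (fun i => by rw [la214v122x_lowerCorner]; exact la214Floor54_hq i) (εp := -17/2) la214Floor54_mu_le
  intro p hp
  have h' := h p hp
  simp only [la214Emery_tpd, la214Emery_tpp, Entry.encl_ofEnds_fst, Entry.encl_ofEnds_snd, la214Floor54_q0,
    Matrix.cons_val_zero, Matrix.cons_val_one, Matrix.cons_val_two, Matrix.cons_val, Matrix.head_cons, Matrix.tail_cons] at h'
  refine h'.trans (le_of_eq ?_)
  push_cast
  ring

/-- **Reading at the face centre** `(t_pd, t_pp) = (281/200, 14/25)` with the lower tail `(1.7, 0, 4.83, 3.39)` read at level `−17/2`: the four weights are `1/4` each, so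
`P_cell ≤ 6 log 2 + β·(588601/16000 + 6394021/156250 + 126879/3200 + 54123877/1250000)/4 = 6 log 2 + β·80329043/2000000` (40.1645215·β; the constant word gives 43.2991016·β here).
[cite: Israel1979, Thm. I.3.4] -/
theorem emeryBoxLa214v123_faceCentre_pressureCap_m17o2 {β : ℝ} (hβ : 0 ≤ β) :
    emeryCellPressure β (emeryLine cuprateSigns (![281/200, 14/25, -34/5, -17/2, 483/100, 339/100] : Fin 6 → ℝ)) ≤
      6 * Real.log 2 + β * (80329043/2000000) := by
  have hM : ∀ i : Fin 4, emeryCellPressure β (emeryLine cuprateSigns (lowerCorner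
      (emeryLo (-17/2) la214Emery_tpd la214Emery_tpp la214Emery_Delta la214Emery_Udd_v122 la214Emery_Upp_exact)
      (emeryHi (-17/2) la214Emery_tpd la214Emery_tpp la214Emery_Delta la214Emery_Udd_v122 la214Emery_Upp_exact) i)) ≤
      6 * Real.log 2 + β * (-la214Floor54_q0 i / 2) := fun i =>
    (emeryCellPressure_corner_level_le hβ cuprateSigns _ _ _ _ _ i (la214Floor54_mu_le i)).trans (by
      have h := emeryCellPressure_tiltedCorner_le_of_cuO4Certificate hβ
        (emeryLine cuprateSigns (lowerCorner (emeryLo 0 la214Emery_tpd la214Emery_tpp la214Emery_Delta la214Emery_Udd_v122 la214Emery_Upp_exact)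
          (emeryHi 0 la214Emery_tpd la214Emery_tpp la214Emery_Delta la214Emery_Udd_v122 la214Emery_Upp_exact) i)) (la214Floor54_mu i) (M := 2) two_pos
        (G := (fun _ : Fin 4 => (0 : FermionOp emeryCuO4Window)) i) (fun ω' _ => re_expect_zero_cuO4 ω') (q₀ := la214Floor54_q0 i)
        (by rw [la214v122x_lowerCorner]; simpa using la214Floor54_hq i)
      simpa using h)
  have h := emeryCellPressure_line_le_bilinear hβ cuprateSigns _ _ hM (a := 1/2) (b := 1/2) (by norm_num) (by norm_num) (by norm_num) (by norm_num)
    (q := (![281/200, 14/25, -34/5, -17/2, 483/100, 339/100] : Fin 6 → ℝ))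
    (by simp [emeryLo, emeryHi, la214Emery_tpd, Entry.encl_ofEnds_fst, Entry.encl_ofEnds_snd]; norm_num)
    (by simp [emeryLo, emeryHi, la214Emery_tpp, Entry.encl_ofEnds_fst, Entry.encl_ofEnds_snd]; norm_num)
    (by simp [emeryLo, la214Emery_Delta, Entry.encl_ofEnds_fst]; norm_num)
    (by simp [emeryLo])
    (by simp [emeryLo, la214Emery_Udd_v122, Entry.encl_ofEnds_fst])
    (by simp [emeryLo, la214Emery_Upp_exact, Entry.encl_ofEnds_fst])
  refine h.trans (le_of_eq ?_)
  simp [la214Floor54_q0]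
  ring

/-- **The pointwise T-corner family floor on La₂CuO₄** (lower edge of the band; `kryFam_La214T_tlhl`, N = 19, 20, 21), cuprate signs, level `−17/2`, every β ≥ 0:
at every point `p`, `¼·log Σⱼ exp(−β·Σ_k q_k(p)·ℓⱼₖ) ≤ P_cell(β, θ(p))` with the members' exact affine Rayleigh forms. [cite: Ruelle1969, §2.5–2.6] -/
theorem emeryBoxLa214v123_pressureFloorPointFamT_m17o2 {β : ℝ} (hβ : 0 ≤ β) :
    HoldsOn (fun p : EmeryCoord → ℝ =>
      Real.log (∑ j : Fin 3, Real.exp (-(β * ∑ k, emeryLineCoords (((-17/2 : ℚ)) : ℝ) p k *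
        lineCoeff cuprateSigns (fun a => ((kryFam_La214T_tlhl_S j a : ℤ) : ℝ) / ((kryFam_La214T_tlhl_NN j : ℤ) : ℝ)) k))) / 4 ≤
        emeryCellPressure β (emeryLine cuprateSigns (emeryLineCoords (((-17/2 : ℚ)) : ℝ) p))) emeryBoxLa214v123 :=
  holdsOn_emeryCellPressureFloor_pointFamily emeryBoxLa214v123 _ cuprateSigns hβ
    (φ := fun i => ((kryFam_La214T_tlhl i).unit : Fock (Orb (Fin 1 ×ₗ Fin 12)))) kryFam_La214T_tlhl_orthonormal
    (T := fun i a => ((kryFam_La214T_tlhl_S i a : ℤ) : ℝ) / ((kryFam_La214T_tlhl_NN i : ℤ) : ℝ)) kryFam_La214T_tlhl_traces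

end Summit.Ventures.CertifiedManyBodySolver.Downfold

end
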